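import Literature.Algebra.Polynomial.CircuitOptimalConstant
import Literature.Algebra.Polynomial.SoncSageDecompositions

/-!
# The SONC bound as a geometric program (Iliman–de Wolff, Ghasemi–Marshall)

[cite: IlimanDewolff2016GP, Theorem 11 («Suppose that for every α ∈ Δ(f) there exist
a_{α,1}, …, a_{α,n} ≥ 0 … such that (1) |f_α| ≤ ∏_{j=1}^n (a_{α,j}/λ_j^{(α)})^{λ_j^{(α)}} for
|α| = 2d, (2) f_{α(j)} ≥ ∑_{α ∈ Δ(f)} a_{α,j} for all 1 ≤ j ≤ n, (3) f_0 − r ≥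
∑_{α ∈ Δ^{<2d}(f)} λ_0^{(α)} |f_α|^{1/λ_0^{(α)}}
∏_{j=1}^n (λ_j^{(α)}/a_{α,j})^{λ_j^{(α)}/λ_0^{(α)}}.  Then … f − r is a SONC»; proof:
«Solving (1') for a_{α,0} yields a_{α,0} ≥ λ_0^{(α)} |f_α|^{1/λ_0}
∏ (λ_j/a_{α,j})^{λ_j/λ_0}»), Corollary 13 (f_gp = f* for a single inner term), Corollary 17
(«f_gp = f_0 − m* where m* is given by the following geometric program: minimize
∑_α λ_0^{(α)} |f_α|^{1/λ_0^{(α)}} ∏ (λ_j^{(α)}/a_{α,j})^{λ_j^{(α)}/λ_0^{(α)}} such that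
∑_α a_{α,j}/f_{α(j)} ≤ 1»), §1 («In [GP] Ghasemi and Marshall show that these certificates can be
translated into checking feasibility of a geometric program»)]
[cite: MagronSeidlerDewolff2019, §2.2 (program (SONC); «Hence, b₀ − GP_opt is a lower bound for
p»)]

`SoncSageDecompositions.sonc_lowerBound` certifies `b_{a₀} − ∑_β X_{β,a₀} ≤ p` from a SONC
certificate `X` (circuit coefficients, the constant column `X_{β,a₀}` being the shifts).  This
file makes the source's reduction to a GEOMETRIC PROGRAM explicit: for a fixed split
`s_{β,a} > 0` of the non-constant outer coefficients, the circuit condition on the constant entry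
is solved in closed form —
`|c| ≤ Θ(s[a₀ ↦ t], λ) ⟺ (|c|/Θ(s[a₀ ↦ 1], λ))^{1/λ_{a₀}} ≤ t` (`abs_le_circuitNumber_update_iff`,
reference value `1`), and that least shift is the source's objective term
`λ_{a₀} |c|^{1/λ_{a₀}} ∏_{a ≠ a₀} (λ_a/s_a)^{λ_a/λ_{a₀}}` (`gpShift_eq`).  Consequences:

* every feasible split gives the bound
  `b_{a₀} − ∑_β (|c_β|/Θ(s_β[a₀ ↦ 1], λ^{(β)}))^{1/λ^{(β)}_{a₀}}` (`sonc_lowerBound_of_split`: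
  the GP objective value at a feasible point is a lower bound);
* it is the best SONC bound with that split (`sonc_bound_le_split_bound`: any certificate's
  constant entries dominate the least shifts — Theorem 11, (1′) ⟺ (3));
* for a single inner term the full split `s = b` recovers the exact minimum of
  `CircuitOptimalConstant` (`gpShift_eq_mul`, `isLeast_circuitPolynomial_gp`: `f_gp = f*`,
  Corollary 13).

Optimising over the splits (the GP itself, convex after `a = exp y`) is not formalised here.
All statements are fully proved; no named facts are introduced.
-/

namespace Literature.Algebra.Polynomial.CircuitGeometricProgram

open Finset Literature.Algebra.Polynomial.CircuitNumberNonnegativity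
open Literature.Algebra.Polynomial.CircuitOptimalConstant
open Literature.Algebra.Polynomial.SoncSageDecompositions

section Shift

variable {ι : Type*} [Fintype ι] [DecidableEq ι]

omit [Fintype ι] in
/-- Positivity of a positive vector with one entry replaced by a positive number. [folklore] -/
private theorem update_pos {s : ι → ℝ} (hs : ∀ j, 0 < s j) (j₀ : ι) {t : ℝ} (ht : 0 < t) (j : ι) :
    0 < Function.update s j₀ t j := by
  rcases eq_or_ne j j₀ with rfl | h
  · rwa [Function.update_self]
  · rw [Function.update_of_ne h]; exact hs j

/-- **The least admissible shift** («solving (1′) for a_{α,0}»).  For positive reference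
coefficients `b`, weights `λ > 0` and `t ≥ 0`:
`|c| ≤ Θ(b[j₀ ↦ t], λ) ⟺ b_{j₀} (|c| / Θ(b, λ))^{1/λ_{j₀}} ≤ t`.
[cite: IlimanDewolff2016GP, Theorem 11 (proof, the display after «Solving (1') for a_{α,0}
yields»)] -/
theorem abs_le_circuitNumber_update_iff {b w : ι → ℝ} (hb : ∀ j, 0 < b j) (hw : ∀ j, 0 < w j)
    (j₀ : ι) {t : ℝ} (ht : 0 ≤ t) (c : ℝ) :
    |c| ≤ circuitNumber (Function.update b j₀ t) w ↔
      b j₀ * (|c| / circuitNumber b w) ^ (1 / w j₀) ≤ t := by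
  rw [circuitNumber_update hb hw j₀ ht,
    le_mul_rpow_iff (abs_nonneg c) (circuitNumber_pos hb hw) (div_nonneg ht (hb j₀).le) (hw j₀),
    le_div_iff₀ (hb j₀), mul_comm]

/-- **The GP objective term.**  With reference value `1` at the constant vertex the least shift
for the split `s > 0` is the source's
`λ_{j₀} |c|^{1/λ_{j₀}} ∏_{j ≠ j₀} (λ_j/s_j)^{λ_j/λ_{j₀}} = (|c| / Θ(s[j₀ ↦ 1], λ))^{1/λ_{j₀}}`.
[cite: IlimanDewolff2016GP, Theorem 11 (3) and Corollary 17 (the objective of the geometric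
program)] -/
theorem gpShift_eq {s w : ι → ℝ} (hs : ∀ j, 0 < s j) (hw : ∀ j, 0 < w j) (j₀ : ι) (c : ℝ) :
    (|c| / circuitNumber (Function.update s j₀ 1) w) ^ (1 / w j₀)
      = w j₀ * |c| ^ (1 / w j₀) * ∏ j ∈ univ.erase j₀, (w j / s j) ^ (w j / w j₀) := by
  have h1 : ∀ j, 0 < Function.update s j₀ (1 : ℝ) j := update_pos hs j₀ one_pos
  have key := optimalShift_eq h1 hw j₀ c
  rw [Function.update_self, one_mul, one_mul] at key
  rw [key, ← mul_prod_erase _ _ (mem_univ j₀), Function.update_self, div_one,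
    div_self (hw j₀).ne', Real.rpow_one]
  have hP : ∏ j ∈ univ.erase j₀, (w j / Function.update s j₀ 1 j) ^ (w j / w j₀)
      = ∏ j ∈ univ.erase j₀, (w j / s j) ^ (w j / w j₀) :=
    prod_congr rfl fun j hj => by rw [Function.update_of_ne (ne_of_mem_erase hj)]
  rw [hP]
  ring

/-- **Change of reference value**:
`(|c| / Θ(b[j₀ ↦ 1], λ))^{1/λ_{j₀}} = b_{j₀} (|c| / Θ(b, λ))^{1/λ_{j₀}}` — the GP shift
computed from the full split `s = b` is the optimal shift `m⋆` of
`CircuitOptimalConstant`.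
[cite: IlimanDewolff2016GP, Corollary 17 (the objective at a_{α,j} = f_{α(j)}) with Theorem 11
(proof, homogenisation: Θ scales by (t/b_{j₀})^{λ_{j₀}})] -/
theorem gpShift_eq_mul {b w : ι → ℝ} (hb : ∀ j, 0 < b j) (hw : ∀ j, 0 < w j) (j₀ : ι) (c : ℝ) :
    (|c| / circuitNumber (Function.update b j₀ 1) w) ^ (1 / w j₀)
      = b j₀ * (|c| / circuitNumber b w) ^ (1 / w j₀) := by
  have hΘ : 0 < circuitNumber b w := circuitNumber_pos hb hw
  have hb0 : 0 < b j₀ := hb j₀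
  rw [circuitNumber_update hb hw j₀ zero_le_one, one_div (b j₀), Real.inv_rpow hb0.le,
    div_mul_eq_div_div, div_inv_eq_mul,
    Real.mul_rpow (div_nonneg (abs_nonneg c) hΘ.le) (Real.rpow_nonneg hb0.le _),
    ← Real.rpow_mul hb0.le, mul_one_div_cancel (hw j₀).ne', Real.rpow_one, mul_comm]

end Shift

section Program

variable {n : Type*} [Fintype n] {A : Type*} [Fintype A] [DecidableEq A] {B : Type*} [Fintype B]

/-- **Every feasible split certifies a lower bound** (the GP objective value at a feasible point).
Outer monomial squares `b_a x^{e(a)}` (`e(a₀) = 0`), inner terms `c_β x^{f(β)}` with barycentric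
weights `λ^{(β)} > 0`; a split `s_{β,a} > 0` with column sums `∑_β s_{β,a} ≤ b_a` (`a ≠ a₀`).  Then
for all `x ∈ ℝⁿ`:
`b_{a₀} − ∑_β (|c_β| / Θ(s_β[a₀ ↦ 1], λ^{(β)}))^{1/λ^{(β)}_{a₀}}`
`≤ ∑_a b_a x^{e(a)} + ∑_β c_β x^{f(β)}`.
[cite: IlimanDewolff2016GP, Theorem 11 ((1)–(3) ⇒ f − r is a SONC, with r = f_0 − ∑ m_α(a))]
[cite: MagronSeidlerDewolff2019, §2.2 («b₀ − GP_opt is a lower bound for p»)] -/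
theorem sonc_lowerBound_of_split {e : A → n → ℕ} (he : ∀ a i, Even (e a i)) {a₀ : A}
    (he0 : ∀ i, e a₀ i = 0) {f : B → n → ℕ} (b : A → ℝ) (c : B → ℝ) {s w : B → A → ℝ}
    (hs : ∀ β a, 0 < s β a) (hw : ∀ β a, 0 < w β a) (hw1 : ∀ β, ∑ a, w β a = 1)
    (hbary : ∀ β i, (f β i : ℝ) = ∑ a, w β a * e a i)
    (hcol : ∀ a, a ≠ a₀ → ∑ β, s β a ≤ b a) (x : n → ℝ) :
    b a₀ - ∑ β, (|c β| / circuitNumber (Function.update (s β) a₀ 1) (w β)) ^ (1 / w β a₀)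
      ≤ (∑ a, b a * ∏ i, x i ^ e a i) + ∑ β, c β * ∏ i, x i ^ f β i := by
  set m : B → ℝ :=
    fun β => (|c β| / circuitNumber (Function.update (s β) a₀ 1) (w β)) ^ (1 / w β a₀) with hm
  have h1 : ∀ β a, 0 < Function.update (s β) a₀ (1 : ℝ) a := fun β => update_pos (hs β) a₀ one_pos
  have hm0 : ∀ β, 0 ≤ m β := fun β =>
    Real.rpow_nonneg (div_nonneg (abs_nonneg _) (circuitNumber_pos (h1 β) (hw β)).le) _
  have hX : ∀ β a, 0 ≤ Function.update (s β) a₀ (m β) a := by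
    intro β a
    rcases eq_or_ne a a₀ with rfl | h
    · rw [Function.update_self]; exact hm0 β
    · rw [Function.update_of_ne h]; exact (hs β a).le
  have hcol' : ∀ a, a ≠ a₀ → ∑ β, Function.update (s β) a₀ (m β) a ≤ b a := by
    intro a ha
    simp_rw [Function.update_of_ne ha]
    exact hcol a ha
  have hcirc : ∀ β, |c β| ≤ circuitNumber (Function.update (s β) a₀ (m β)) (w β) ∨
      ((∀ i, Even (f β i)) ∧ -circuitNumber (Function.update (s β) a₀ (m β)) (w β) ≤ c β) := by
    intro β
    left
    have h := (abs_le_circuitNumber_update_iff (h1 β) (hw β) a₀ (hm0 β) (c β)).mpr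
      (by rw [Function.update_self, one_mul])
    rwa [Function.update_idem] at h
  have key := sonc_lowerBound he he0 hX (fun β a => (hw β a).le) hw1 hbary hcol' hcirc x
  simpa only [Function.update_self] using key

omit [Fintype n] in
/-- **The GP shift is the best constant entry for a fixed split** (Theorem 11, (1′) ⟺ (3)): if a
SONC certificate `X > 0` passes the circuit tests `|c_β| ≤ Θ(X_β, λ^{(β)})`, then its constant
entries dominate the least shifts of the split `(X_{β,a})_{a ≠ a₀}`, so its bound
`b₀ − ∑_β X_{β,a₀}` is at most the GP value `b₀ − ∑_β (|c_β| / Θ(X_β[a₀ ↦ 1], λ^{(β)}))^{1/λ_{a₀}}`.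
[cite: IlimanDewolff2016GP, Theorem 11 (proof: «(2') follows from (2) and (3) and» the solved
inequality for a_{α,0})] -/
theorem sonc_bound_le_split_bound {a₀ : A} {c : B → ℝ} {X w : B → A → ℝ} (hX : ∀ β a, 0 < X β a)
    (hw : ∀ β a, 0 < w β a) (hcirc : ∀ β, |c β| ≤ circuitNumber (X β) (w β)) (b₀ : ℝ) :
    b₀ - ∑ β, X β a₀
      ≤ b₀ - ∑ β, (|c β| / circuitNumber (Function.update (X β) a₀ 1) (w β)) ^ (1 / w β a₀) := by
  have h : ∀ β, (|c β| / circuitNumber (Function.update (X β) a₀ 1) (w β)) ^ (1 / w β a₀)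
      ≤ X β a₀ := by
    intro β
    have h1 : ∀ a, 0 < Function.update (X β) a₀ (1 : ℝ) a := update_pos (hX β) a₀ one_pos
    have h2 := (abs_le_circuitNumber_update_iff h1 (hw β) a₀ (hX β a₀).le (c β)).mp
      (by rw [Function.update_idem, Function.update_eq_self]; exact hcirc β)
    rwa [Function.update_self, one_mul] at h2
  linarith [sum_le_sum fun β (_ : β ∈ univ) => h β]

end Program

section Single

variable {ι : Type*} [Fintype ι] [DecidableEq ι] {n : Type*} [Fintype n]

/-- **`f_gp = f*` for a single inner term** (Corollary 13) in GP normal form: for a proper circuit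
polynomial the GP value of the full split, `b_{j₀} − (|c| / Θ(b[j₀ ↦ 1], λ))^{1/λ_{j₀}}`, is the
least value of `p` on `ℝⁿ`.
[cite: IlimanDewolff2016GP, Corollary 13 («if #Ω(f) = 1, then … f_gp = f*») and Corollary 17] -/
theorem isLeast_circuitPolynomial_gp [DecidableEq n] {b w : ι → ℝ} (hb : ∀ j, 0 < b j)
    (hw : ∀ j, 0 < w j) (hw1 : ∑ j, w j = 1) {a : ι → n → ℕ} (ha : ∀ j i, Even (a j i))
    (hα : AffineIndependent ℝ fun j i => (a j i : ℝ)) {β : n → ℕ}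
    (hβ : ∀ i, (β i : ℝ) = ∑ j, w j * a j i) {j₀ : ι} (hj₀ : ∀ i, a j₀ i = 0) {c : ℝ}
    (hc0 : c ≠ 0) (hprop : c < 0 ∨ ∃ i, Odd (β i)) :
    IsLeast (Set.range fun x : n → ℝ => ∑ j, b j * ∏ i, x i ^ a j i + c * ∏ i, x i ^ β i)
      (b j₀ - (|c| / circuitNumber (Function.update b j₀ 1) w) ^ (1 / w j₀)) := by
  rw [gpShift_eq_mul hb hw j₀ c, ← mul_one_sub]
  exact isLeast_circuitPolynomial hb hw hw1 ha hα hβ hj₀ hc0 hprop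

end Single

end Literature.Algebra.Polynomial.CircuitGeometricProgram
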